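import Literature.IUT.HodgeTheaters.InitialThetaDataRemarks
import Literature.NumberTheory.EllipticCurves.WeierstrassConjugateThreeTorsionProofs
import Literature.NumberTheory.EllipticCurves.TorsionRationalDescentProofs
import Mathlib.AlgebraicGeometry.EllipticCurve.IsomOfJ
import HarnessLib

/-!
# [IUTchI] Remark 3.1.5: `K` is Galois over `F_mod` — proof

`Proofs` companion (theorems only; no definitions, no named facts, no instances) of
`Literature.IUT.HodgeTheaters.InitialThetaDataRemarks` (abc-iut-L5-t2), discharging the named fact
`InitialThetaData.KGaloisOverFieldOfModuli` typed there from S. Mochizuki, *Inter-universal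
Teichmüller theory I*, Remark 3.1.5, first sentence (kurims May-2020 manuscript p. 65): "Note
that since the `3`-torsion points of `E_F` are rational over `F`, and `F` is Galois over `F_mod`
[cf. Definition 3.1, (b)], it follows [cf., e.g., [IUTchIV], Proposition 1.8, (iv)] that `K` is
Galois over `F_mod`."
[claim: Mochizuki2012, status: disputed] — here a THEOREM about the REAL data of
`InitialThetaData F K Fbar E l P` ([IUTchI] Def. 3.1: `F_mod = ℚ(j_E) ⊆ F`, `F/F_mod` Galois, the
`6`-torsion of `E_F` rational over `F`, `K` = the field cut out by the `l`-torsion, `range_K_iff`).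

## The argument (the twist argument behind [IUTchIV] Prop. 1.8 (iv); Silverman *AEC* III.1.4(b),
## III.10.1, X.5.4)

Let `σ ∈ Aut(F̄)` fix `F_mod` pointwise. (1) `F/F_mod` is normal, so `σ(F) = F`
(`AlgHom.restrictNormal`). (2) The conjugate equation `E^σ := (E_{F̄})^σ` has the same
`j`-invariant (`j_E ∈ F_mod`), so Mathlib's `exists_variableChange_of_j_eq` gives a change of
variables `C` over `F̄` with `C • E_{F̄} = E^σ`, i.e. an isomorphism `e : E(F̄) ≃+ E^σ(F̄)` (the
tree's `VariableChange.pointEquiv`); `σ` acting on coordinates is a bijective group homomorphism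
`σ̃ : E(F̄) → E^σ(F̄)` (the tree's `exists_pointHom_map`). (3) For `ρ ∈ Gal(F̄/F)` the conjugate
`ρ(C)` again satisfies `ρ(C) • E_{F̄} = E^σ` (both equations have coefficients in `F`), so
`A_ρ := C⁻¹ ρ(C)` is an AUTOMORPHISM of `E_{F̄}`. Every `3`-torsion point of `E_{F̄}` and of `E^σ`
has coordinates in `F` (they are `σ̃` of `F`-rational points), so `A_ρ` fixes `E[3]` pointwise;
since `#E[3] = 9` and a non-trivial Weierstrass automorphism in characteristic `0` fixes at most
`O, ±Q` over one abscissa or is `−1` (the tree's `VariableChange.eq_one_of_three_torsion_fixed`,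
`exists_three_torsion_pair`), `A_ρ = 1`, i.e. `ρ(C) = C`. (4) Hence if `ρ` fixes `E[l]` pointwise
it fixes the coordinates of `e(E[l]) = E^σ[l] = σ̃(E[l])`, i.e. `σ⁻¹ρσ` fixes `E[l]` pointwise
(and `F`, by (1)); by `range_K_iff` it fixes `K`, so `ρ` fixes `σ(K)`; by `range_K_iff` again
`σ(K) ⊆ K`.

Nothing here takes a side on [IUTchIII] Cor. 3.12; this is a kernel check of one printed claim
about the initial Θ-data. Axioms: `propext`, `Classical.choice`, `Quot.sound`.

## References

* [Mochizuki2012] S. Mochizuki, IUT I, Def. 3.1, Rmk. 3.1.5 (p. 65); IUT IV, Prop. 1.8 (iv).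
* [SilvermanAEC2009] J. H. Silverman, *The Arithmetic of Elliptic Curves*, 2nd ed., III.1.4(b),
  III.10.1, X.5.4.
-/

noncomputable section

open scoped Classical
open WeierstrassCurve

universe u v w

namespace Literature.IUT.HodgeTheaters

open Literature.NumberTheory.EllipticCurves

/-! ## §3. [IUTchI] Remark 3.1.5 for initial Θ-data -/

section Rmk315

variable {F : Type u} {K : Type v} {Fbar : Type w} [Field F] [NumberField F] [Field K]
  [NumberField K] [Algebra F K] [Field Fbar] [Algebra F Fbar] [Algebra K Fbar]
  {E : WeierstrassCurve F} [E.IsElliptic] {l : ℕ} {P : BadPlacePredicates K}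
  (D : InitialThetaData F K Fbar E l P)

namespace InitialThetaData

include D

/-- "`F` is Galois over `F_mod`" (Def. 3.1 (b), used in Rmk. 3.1.5): a ring automorphism of `F̄`
fixing `F_mod` pointwise carries `F ⊆ F̄` into itself (normality of `F/F_mod`; Mathlib's
`AlgHom.restrictNormal`). [claim: Mochizuki2012, status: disputed] -/
theorem map_F_mem_range_of_fixes_fieldOfModuli (σ : Fbar ≃+* Fbar)
    (hσ : ∀ x : fieldOfModuli E, σ (algebraMap F Fbar (x : F)) = algebraMap F Fbar (x : F))
    (a : F) : σ (algebraMap F Fbar a) ∈ Set.range (algebraMap F Fbar) := by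
  haveI := D.isGalois_fieldOfModuli
  -- `F̄` is an `F_mod`-algebra through `F` (Mathlib's `IntermediateField` tower instances)
  have hσ' : ∀ x : fieldOfModuli E, σ (algebraMap (fieldOfModuli E) Fbar x) =
      algebraMap (fieldOfModuli E) Fbar x := fun x => by
    rw [IsScalarTower.algebraMap_apply (fieldOfModuli E) F Fbar]
    exact hσ x
  let σ' : Fbar →ₐ[fieldOfModuli E] Fbar := AlgHom.mk (σ : Fbar →+* Fbar) hσ'
  exact ⟨σ'.restrictNormal F a, AlgHom.restrictNormal_commutes σ' F a⟩

/-- **The heart of Rmk. 3.1.5** (the twist argument of [IUTchIV] Prop. 1.8 (iv), module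
docstring): if `σ ∈ Aut(F̄)` fixes `F_mod` pointwise and `ρ ∈ Gal(F̄/F)` fixes the `l`-torsion of
`E_F` pointwise, then `ρ` fixes the `σ`-conjugates of the coordinates of every `l`-torsion point
of `E_F(F̄)`. [claim: Mochizuki2012, status: disputed] -/
theorem apply_conj_torsion_eq_of_fixesTorsion (σ : Fbar ≃+* Fbar)
    (hσ : ∀ x : fieldOfModuli E, σ (algebraMap F Fbar (x : F)) = algebraMap F Fbar (x : F))
    (ρ : Fbar ≃ₐ[F] Fbar) (hρ : FixesTorsion E l ρ) {x y : Fbar}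
    (h : (E.baseChange Fbar).toAffine.Nonsingular x y)
    (hT : (l : ℤ) • (Affine.Point.some x y h : (E.baseChange Fbar).toAffine.Point) = 0) :
    ρ (σ x) = σ x ∧ ρ (σ y) = σ y := by
  haveI := D.isAlgClosure
  haveI := D.isScalarTower
  haveI : IsAlgClosed Fbar := IsAlgClosure.isAlgClosed F
  haveI : CharZero Fbar := charZero_of_injective_algebraMap (algebraMap F Fbar).injective
  have h2 : (2 : Fbar) ≠ 0 := by norm_num
  have h3 : (3 : Fbar) ≠ 0 := by norm_num
  -- the ring homomorphisms underlying `ρ` and `σ`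
  obtain ⟨ρr, hρr⟩ : ∃ ρr : Fbar →+* Fbar, ∀ z, ρr z = ρ z :=
    ⟨(ρ : Fbar →ₐ[F] Fbar), fun _ => rfl⟩
  have hσr : ∀ z, (σ : Fbar →+* Fbar) z = σ z := fun _ => rfl
  -- (1) `F/F_mod` normal: `σ(F) = F`, so `ρ` fixes `σ(F)` pointwise
  have hF : ∀ a : F, ∃ a' : F, algebraMap F Fbar a' = σ (algebraMap F Fbar a) := fun a =>
    D.map_F_mem_range_of_fixes_fieldOfModuli σ hσ a
  have hρι : ∀ a : F, ρr (algebraMap F Fbar a) = algebraMap F Fbar a := fun a => by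
    rw [hρr]
    exact ρ.commutes a
  have hρσι : ∀ a : F, ρr (σ (algebraMap F Fbar a)) = σ (algebraMap F Fbar a) := fun a => by
    obtain ⟨a', ha'⟩ := hF a
    rw [← ha', hρι]
  -- (2) the two equations `W₁ = E_{F̄}`, `W₂ = E^σ`; same `j`-invariant; a change of variables
  let W₁ : WeierstrassCurve Fbar := E.baseChange Fbar
  have hW₁ : W₁ = E.map (algebraMap F Fbar) := rfl
  haveI hW₁ell : W₁.IsElliptic := inferInstanceAs (E.map (algebraMap F Fbar)).IsElliptic
  let W₂ : WeierstrassCurve Fbar := W₁.map (σ : Fbar →+* Fbar)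
  have hW₂ : W₂ = W₁.map (σ : Fbar →+* Fbar) := rfl
  haveI hW₂ell : W₂.IsElliptic := inferInstanceAs (W₁.map (σ : Fbar →+* Fbar)).IsElliptic
  have hjmem : E.j ∈ fieldOfModuli E :=
    IntermediateField.subset_adjoin ℚ {E.j} (Set.mem_singleton _)
  have hj : W₁.j = W₂.j := by
    have e1 : W₂.j = (σ : Fbar →+* Fbar) W₁.j := W₁.map_j _
    have e2 : W₁.j = algebraMap F Fbar E.j := E.map_j _
    rw [e1, e2]
    exact (hσ ⟨E.j, hjmem⟩).symm
  obtain ⟨C, hC⟩ := exists_variableChange_of_j_eq W₁ W₂ hj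
  -- (3) `ρ` fixes both equations, so `ρ(C)` is another such change of variables
  have hW₁ρ : W₁.map ρr = W₁ := by
    rw [hW₁, WeierstrassCurve.map_map]
    ext <;> simp only [map_a₁, map_a₂, map_a₃, map_a₄, map_a₆, RingHom.coe_comp,
      Function.comp_apply] <;> exact hρι _
  have hW₂ρ : W₂.map ρr = W₂ := by
    simp only [hW₂, hW₁, WeierstrassCurve.map_map]
    ext <;> simp only [map_a₁, map_a₂, map_a₃, map_a₄, map_a₆, RingHom.coe_comp,
      Function.comp_apply] <;> exact hρσι _
  let Cρ : VariableChange Fbar := C.map ρr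
  have hCρ_def : Cρ = C.map ρr := rfl
  have hCρ : Cρ • W₁ = W₂ := by
    have hmv := WeierstrassCurve.map_variableChange W₁ C ρr
    rw [hW₁ρ, hC, hW₂ρ] at hmv
    exact hmv
  have hA : (C⁻¹ * Cρ) • W₁ = W₁ := by rw [mul_smul, hCρ, ← hC, inv_smul_smul]
  -- `σ̃ : E(F̄) → E^σ(F̄)`
  obtain ⟨f, hf⟩ := exists_pointHom_map W₁ (σ : Fbar →+* Fbar)
  have finj : ∀ Pt : W₁.toAffine.Point, f Pt = 0 → Pt = 0 := by
    rintro (_ | ⟨a, b, hab⟩) hP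
    · exact (Affine.Point.zero_def).symm
    · rw [hf] at hP
      exact absurd hP (Affine.Point.some_ne_zero _)
  -- (i) `3`-torsion points of `E(F̄)` have coordinates in `F` (Def. 3.1 (b): `6`-torsion rational)
  have rat3 : ∀ {a b : Fbar} (hab : W₁.toAffine.Nonsingular a b),
      (3 : ℕ) • (Affine.Point.some a b hab : W₁.toAffine.Point) = 0 →
        (∃ a₀ : F, algebraMap F Fbar a₀ = a) ∧ (∃ b₀ : F, algebraMap F Fbar b₀ = b) := by
    intro a b hab h3T
    have h6 : (6 : ℤ) • (Affine.Point.some a b hab : W₁.toAffine.Point) = 0 := by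
      rw [show (6 : ℤ) = ((3 + 3 : ℕ) : ℤ) by norm_num, natCast_zsmul, add_nsmul, h3T, add_zero]
    obtain ⟨Q, hQ⟩ := D.torsion_six_rational (Affine.Point.some a b hab) h6
    rcases Q with _ | ⟨a₀, b₀, h₀⟩
    · rw [← Affine.Point.zero_def, map_zero] at hQ
      exact absurd hQ.symm (Affine.Point.some_ne_zero _)
    · rw [Affine.Point.map_some, Affine.Point.some.injEq] at hQ
      exact ⟨⟨a₀, hQ.1⟩, ⟨b₀, hQ.2⟩⟩
  -- (ii) `3`-torsion points of `E^σ(F̄)` have `ρ`-fixed coordinates (they are `σ̃` of (i))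
  have fix3 : ∀ {a' b' : Fbar} (h' : W₂.toAffine.Nonsingular a' b'),
      (3 : ℕ) • (Affine.Point.some a' b' h' : W₂.toAffine.Point) = 0 →
        ρr a' = a' ∧ ρr b' = b' := by
    intro a' b' h' h3
    obtain ⟨Pt, hPt⟩ := exists_eq_pointHom_of_ringEquiv W₁ σ f hf (Affine.Point.some a' b' h')
    rcases Pt with _ | ⟨a, b, hab⟩
    · rw [← Affine.Point.zero_def, map_zero] at hPt
      exact absurd hPt.symm (Affine.Point.some_ne_zero _)
    · have h3P : (3 : ℕ) • (Affine.Point.some a b hab : W₁.toAffine.Point) = 0 :=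
        finj _ (by rw [map_nsmul, hPt, h3])
      obtain ⟨⟨a₀, ha₀⟩, ⟨b₀, hb₀⟩⟩ := rat3 hab h3P
      rw [hf, Affine.Point.some.injEq] at hPt
      obtain ⟨rfl, rfl⟩ := hPt
      rw [hσr, hσr, ← ha₀, ← hb₀]
      exact ⟨hρσι a₀, hρσι b₀⟩
  -- (iii) `A_ρ = C⁻¹ ρ(C)` fixes every `3`-torsion point of `E(F̄)`
  have fixA : ∀ T : W₁.toAffine.Point, (3 : ℕ) • T = 0 →
      Affine.Point.congrEquiv hA (VariableChange.pointEquiv W₁ (C⁻¹ * Cρ) T) = T := by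
    rintro (_ | ⟨a, b, hab⟩) h3T
    · simp only [← Affine.Point.zero_def, map_zero]
    · obtain ⟨⟨a₀, ha₀⟩, ⟨b₀, hb₀⟩⟩ := rat3 hab h3T
      have hρa : ρr a = a := by rw [← ha₀]; exact hρι a₀
      have hρb : ρr b = b := by rw [← hb₀]; exact hρι b₀
      have h3e : (3 : ℕ) • Affine.Point.congrEquiv hC
          (VariableChange.pointEquiv W₁ C (Affine.Point.some a b hab)) = 0 := by
        rw [← map_nsmul, ← map_nsmul, h3T, map_zero, map_zero]
      rw [VariableChange.pointEquiv_some, Affine.Point.congrEquiv_some] at h3e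
      obtain ⟨hρX, hρY⟩ := fix3 _ h3e
      rw [VariableChange.pointEquiv_some, Affine.Point.congrEquiv_some, Affine.Point.some.injEq]
      constructor
      · calc (C⁻¹ * Cρ).toX a = C⁻¹.toX (Cρ.toX (ρr a)) := by rw [toX_mul, hρa]
          _ = C⁻¹.toX (ρr (C.toX a)) := by rw [hCρ_def, ← map_toX_ringHom]
          _ = (C⁻¹ * C).toX a := by rw [hρX, toX_mul]
          _ = a := by rw [inv_mul_cancel, toX_one]
      · calc (C⁻¹ * Cρ).toY a b = C⁻¹.toY (Cρ.toX (ρr a)) (Cρ.toY (ρr a) (ρr b)) := by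
              rw [toY_mul, hρa, hρb]
          _ = C⁻¹.toY (ρr (C.toX a)) (ρr (C.toY a b)) := by
              rw [hCρ_def, ← map_toX_ringHom, ← map_toY_ringHom]
          _ = (C⁻¹ * C).toY a b := by rw [hρX, hρY, toY_mul]
          _ = b := by rw [inv_mul_cancel, toY_one]
  -- (iv) rigidity: `A_ρ = 1`, i.e. `ρ(C) = C`
  obtain ⟨Q₁, Q₂, h3Q₁, h3Q₂, hQ₁0, hQ₂0, hne, hne'⟩ := exists_three_torsion_pair W₁ h3
  have hA1 : C⁻¹ * Cρ = 1 :=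
    VariableChange.eq_one_of_three_torsion_fixed W₁ h2 h3 hA h3Q₁ hQ₁0 hQ₂0 hne hne'
      (fixA Q₁ h3Q₁) (fixA Q₂ h3Q₂)
  have hCρC : Cρ = C := (inv_mul_eq_one.mp hA1).symm
  -- (v) hence `ρ` fixes the coordinates of `e(T)` for every `l`-torsion `T ∈ E(F̄)`
  have keyl : ∀ {a b : Fbar} (hab : W₁.toAffine.Nonsingular a b),
      (l : ℤ) • (Affine.Point.some a b hab : W₁.toAffine.Point) = 0 →
        ρr (C.toX a) = C.toX a ∧ ρr (C.toY a b) = C.toY a b := by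
    intro a b hab hlT
    have hfix := hρ (Affine.Point.some a b hab) hlT
    rw [galoisAct, Affine.Point.map_some, Affine.Point.some.injEq] at hfix
    have ha : ρr a = a := by rw [hρr]; exact hfix.1
    have hb : ρr b = b := by rw [hρr]; exact hfix.2
    constructor
    · rw [map_toX_ringHom, ← hCρ_def, hCρC, ha]
    · rw [map_toY_ringHom, ← hCρ_def, hCρC, ha, hb]
  -- the given `l`-torsion point: `σ̃ T ∈ E^σ[l] = e(E[l])`
  let e : W₁.toAffine.Point ≃+ W₂.toAffine.Point :=
    (VariableChange.pointEquiv W₁ C).trans (Affine.Point.congrEquiv hC)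
  have he : ∀ {a b : Fbar} (hab : W₁.toAffine.Nonsingular a b),
      e (Affine.Point.some a b hab) = Affine.Point.some (C.toX a) (C.toY a b)
        (hC ▸ (VariableChange.nonsingular_iff W₁ C a b).mpr hab) := fun hab => by
    simp only [e, AddEquiv.trans_apply, VariableChange.pointEquiv_some,
      Affine.Point.congrEquiv_some]
  have hQ := hf h
  have hlQ : (l : ℤ) • f (Affine.Point.some x y h) = 0 := by rw [← map_zsmul, hT, map_zero]
  have hlP : (l : ℤ) • e.symm (f (Affine.Point.some x y h)) = 0 := by
    rw [← map_zsmul, hlQ, map_zero]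
  rcases hP : e.symm (f (Affine.Point.some x y h)) with _ | ⟨x', y', h'⟩
  · have h0 : f (Affine.Point.some x y h) = 0 := by
      rw [← e.apply_symm_apply (f _), hP, ← Affine.Point.zero_def, map_zero]
    rw [hQ] at h0
    exact absurd h0 (Affine.Point.some_ne_zero _)
  · rw [hP] at hlP
    obtain ⟨hX, hY⟩ := keyl h' hlP
    have heP : e (Affine.Point.some x' y' h') = f (Affine.Point.some x y h) := by
      rw [← hP, e.apply_symm_apply]
    rw [he, hQ, Affine.Point.some.injEq] at heP
    rw [← hρr, ← hρr, ← hσr x, ← hσr y, ← heP.1, ← heP.2]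
    exact ⟨hX, hY⟩

/-- **[IUTchI] Remark 3.1.5, first sentence (p. 65) — DISCHARGED**: for initial Θ-data
`(F̄/F, X_F, l, C̲_K, V̲, V^bad_mod, ε̲)` the field `K = F(E_F[l])` is Galois over `F_mod`, in the
typed form `InitialThetaData.KGaloisOverFieldOfModuli`: every ring automorphism of `F̄` fixing
`F_mod` pointwise carries `K ⊆ F̄` into itself. Proof: "since the `3`-torsion points of `E_F` are
rational over `F`, and `F` is Galois over `F_mod`" — the twist argument of [IUTchIV] Prop. 1.8
(iv) (`apply_conj_torsion_eq_of_fixesTorsion`) shows that `σ⁻¹ρσ` fixes `E_F[l]` pointwise for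
every `ρ ∈ Gal(F̄/K)`, and `K` is the fixed field of the pointwise stabiliser of `E_F[l]`
(Def. 3.1 (c), `range_K_iff`). [claim: Mochizuki2012, status: disputed] -/
theorem kGaloisOverFieldOfModuli_holds : D.KGaloisOverFieldOfModuli := by
  intro σ hσ y
  haveI := D.isScalarTower
  have hF : ∀ a : F, ∃ a' : F, algebraMap F Fbar a' = σ (algebraMap F Fbar a) := fun a =>
    D.map_F_mem_range_of_fixes_fieldOfModuli σ hσ a
  rw [D.range_K_iff]
  intro ρ hρ
  -- `ρ' := σ⁻¹ ∘ ρ ∘ σ` is an `F`-algebra automorphism of `F̄` …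
  have hcomm : ∀ a : F, ((σ.trans (ρ : Fbar ≃+* Fbar)).trans σ.symm) (algebraMap F Fbar a) =
      algebraMap F Fbar a := by
    intro a
    obtain ⟨a', ha'⟩ := hF a
    rw [RingEquiv.trans_apply, RingEquiv.trans_apply, RingEquiv.symm_apply_eq, ← ha']
    exact ρ.commutes a'
  let ρ' : Fbar ≃ₐ[F] Fbar := AlgEquiv.ofRingEquiv hcomm
  -- … fixing `E_F[l]` pointwise
  have hρ' : FixesTorsion E l ρ' := by
    intro T hlT
    rcases T with _ | ⟨x, y, h⟩
    · simp only [← Affine.Point.zero_def, map_zero]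
    · obtain ⟨hx, hy⟩ := D.apply_conj_torsion_eq_of_fixesTorsion σ hσ ρ hρ h hlT
      rw [galoisAct, Affine.Point.map_some]
      simp only [Affine.Point.some.injEq]
      constructor
      · change σ.symm (ρ (σ x)) = x
        rw [hx, RingEquiv.symm_apply_apply]
      · change σ.symm (ρ (σ y)) = y
        rw [hy, RingEquiv.symm_apply_apply]
  have hfixK := (D.range_K_iff (algebraMap K Fbar y)).mp ⟨y, rfl⟩ ρ' hρ'
  change σ.symm (ρ (σ (algebraMap K Fbar y))) = algebraMap K Fbar y at hfixK
  rw [RingEquiv.symm_apply_eq] at hfixK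
  exact hfixK

end InitialThetaData

end Rmk315

/-! ## §4. [IUTchIV] Prop. 1.8 (iv) for initial Θ-data: `F`-models of `E_F` with rational `3`-torsion

Appended 2026-08-25 (same seat): the real form of [IUTchIV] Prop. 1.8 (iv) landed as
`WeierstrassCurve.exists_variableChange_of_j_eq_of_torsion_fixed`
(`Literature.NumberTheory.EllipticCurves.TorsionRationalDescentProofs`); here it is specialised to the
`3`-torsion clause of Def. 3.1 (b), which is how [IUTchIV] Thm. 1.10 (p. 22) and Cor. 2.2 (ii)
(p. 42) use it: "Moreover, we assume that the `(3·5)`-torsion points of `E_F` are defined over `F` …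
[Thus, it follows from Proposition 1.8, (iv), that `E_F ≅ E_{F_tpd} ×_{F_tpd} F` over `F` …]". -/

section Prop18iv

variable {F : Type u} {K : Type v} {Fbar : Type w} [Field F] [NumberField F] [Field K]
  [NumberField K] [Algebra F K] [Field Fbar] [Algebra F Fbar] [Algebra K Fbar]
  {E : WeierstrassCurve F} [E.IsElliptic] {l : ℕ} {P : BadPlacePredicates K}
  (D : InitialThetaData F K Fbar E l P)

namespace InitialThetaData

include D

/-- **[IUTchIV] Prop. 1.8 (iv) for the curve `E_F` of initial Θ-data** (as used in [IUTchIV]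
Thm. 1.10 p. 22 and Cor. 2.2 (ii) p. 42: "it follows from Proposition 1.8, (iv), that
`E_F ≅ E_{F_tpd} ×_{F_tpd} F` over `F`"): since the `3`-torsion points of `E_F` are rational over `F`
(Def. 3.1 (b), `torsion_six_rational`), every elliptic curve `W` over `F` with `j(W) = j(E_F)` all of
whose `3`-torsion `F̄`-points are `F`-rational is `F`-isomorphic to `E_F`: `C • E_F = W` for a change
of variables `C` over `F` (the tree's `exists_variableChange_of_j_eq_of_torsion_fixed` with `l = 3`,
`L = F̄`). [claim: Mochizuki2012, status: disputed] -/
theorem exists_variableChange_eq_of_j_eq_of_three_torsion_rational (W : WeierstrassCurve F)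
    [W.IsElliptic] (hj : E.j = W.j)
    (hW : ∀ T : (W.baseChange Fbar).toAffine.Point, (3 : ℤ) • T = 0 →
      T ∈ Set.range (Affine.Point.baseChange (W' := W.toAffine) F Fbar)) :
    ∃ C : VariableChange F, C • E = W := by
  haveI := D.isAlgClosure
  haveI := D.isScalarTower
  haveI : IsAlgClosed Fbar := IsAlgClosure.isAlgClosed F
  haveI : Algebra.IsAlgebraic F Fbar := IsAlgClosure.isAlgebraic
  haveI : IsGalois F Fbar := {}
  have h2 : (2 : F) ≠ 0 := by norm_num
  have h3 : (3 : F) ≠ 0 := by norm_num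
  have h3' : ((3 : ℕ) : F) ≠ 0 := by norm_num
  refine exists_variableChange_of_j_eq_of_torsion_fixed (L := Fbar) E W hj h2 h3 Nat.prime_three
    le_rfl h3' ?_ ?_
  · intro σ T hT
    have h6 : (6 : ℤ) • T = 0 := by
      rw [show (6 : ℤ) = 2 * ((3 : ℕ) : ℤ) by norm_num, mul_smul, hT, smul_zero]
    exact Affine.Point.map_algEquiv_eq_self_of_mem_range_baseChange σ (D.torsion_six_rational T h6)
  · intro σ T hT
    have h3T : (3 : ℤ) • T = 0 := by exact_mod_cast hT
    exact Affine.Point.map_algEquiv_eq_self_of_mem_range_baseChange σ (hW T h3T)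

end InitialThetaData

end Prop18iv

end Literature.IUT.HodgeTheaters
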